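import Mathlib
import Summits.ValiantsHypothesis.ValiantsHypothesis.Theses.DivisionGap
import Literature.Computability.AlgebraicComplexity.PermanentIrreducible
import Literature.Computability.AlgebraicComplexity.ValiantConjectureEquivProofs
import HarnessLib

/-!
# Crux `DivisionGap.ZeroOneTransfer` (stmt-ValiantsHypothesis-5066) — what route `DivisionGap` REALLY
# consumes: the 0/1-transfer AT THE SINGLE FAMILY `per`, and modulo H1 it IS the summit

The crux Z = `Theses.DivisionGap.ZeroOneTransfer` (the 0/1 division transfer for EVERY 0/1-coefficient
family whose complexification is in `VP_ℂ`) is wanted by two routes.  For route `FifoMatching` the tree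
records (`Theorems/FifoMatchingNNNotVPTransferAtNN.lean`, ✓ p823474) that only its instance at `NN` is
consumed and that this instance is implied by that route's crux.  This companion file records the same
for route `DivisionGap`, whose assembly is `PerDivisionHard → ZeroOneTransfer → ValiantsHypothesis`
(`Theorems.DivisionGap.assembly_proof`; this file re-derives the two bookkeeping steps inline so as to
import only the route file and Literature):

* the **transfer at `per`** (`TransferAtPer`, inline): IF `(per_n)` is a `VP_ℂ` family THEN for some `c`
  and all `n` some nonzero `h ∈ ℝ≥0[x_ij]` has `L₊(per_n · h) + L₊(h) ≤ 2^((log₂ n + c)^c)` — the instance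
  `σ n := Fin n × Fin n`, `f n := per_n` of Z (`transferAtPer_of_zeroOneTransfer`);
* `valiantsHypothesis_of_transferAtPer_of_somewhereHard` — the assembly with BOTH hypotheses weakened
  (transfer at `per` only; H1 `PerDivisionHard` only at SOME level per scale, as already in
  `DivisionGap.not_isVPFamily_per_of_perDivisionHard_exists`);
* `transferAtPer_of_valiantsHypothesis` — the transfer at `per` is IMPLIED BY THE SUMMIT (vacuously:
  `VP_ℂ ≠ VNP_ℂ ⇒ per ∉ VP_ℂ` by VNP-completeness of `per`, tree theorem
  `perFamily_mem_VP_iff_VP_eq_VNP`);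
* ★ `valiantsHypothesis_iff_transferAtPer` — MODULO H1 (even in its somewhere form) the summit
  `ValiantsHypothesis` is EQUIVALENT to the single-family transfer at `per`.

Consequence for the planner (honest framing, no route verb issued here): the general crux Z is strictly
more than either route consumes; Z can die at an unrelated family (tree:
`ZeroOneTransfer.Negative.zeroOneTransfer_false_of_triangularDimers_hard`) while both single-family
instances (`TransferAtPer` here, `TransferAtNN` for `FifoMatching`) are implied by the respective targets
and hence irrefutable short of refuting those targets.  Nothing here is progress on Z, H1 or `VP ≠ VNP`
(all OPEN); no definitions, no named facts (the auxiliary statements are hypotheses spelled out inline).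
-/

noncomputable section

-- Sub = Summit single-conjunct layout: the duplicated namespace component is mandated by the tree.
set_option linter.dupNamespace false
set_option autoImplicit false

namespace Summit.ValiantsHypothesis.ValiantsHypothesis.Theorems.DivisionGapZeroOneTransfer.TransferAtPer

open MvPolynomial Literature.Computability.AlgebraicComplexity
open scoped NNReal

/-! ### The transfer side: `ZeroOneTransfer ⇒ TransferAtPer ⇐ ValiantsHypothesis` -/

/-- **`ZeroOneTransfer → TransferAtPer`**: the crux Z specialised to the single family
`σ n := Fin n × Fin n`, `f n := per_n` (0/1 coefficients: `coeff_perPoly_nnreal_eq_zero_or_eq_one`;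
complexification `= per_n` over `ℂ`: `map_perPoly_nnreal_family`). [folklore] -/
theorem transferAtPer_of_zeroOneTransfer
    (hZ : Summit.ValiantsHypothesis.ValiantsHypothesis.Theses.DivisionGap.ZeroOneTransfer) :
    IsVPFamily (k := ℂ) (fun n => perPoly (Fin n) ℂ) →
      ∃ c : ℕ, ∀ n : ℕ, ∃ h : MvPolynomial (Fin n × Fin n) ℝ≥0, h ≠ 0 ∧
        complexity (perPoly (Fin n) ℝ≥0 * h) + complexity h ≤ 2 ^ ((Nat.log 2 n + c) ^ c) := by
  intro hVP
  -- `per` over `ℝ≥0` has 0/1 coefficients (cf. `DivisionGap.coeff_perPoly_nnreal_eq_zero_or_eq_one`)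
  have hcoeff : ∀ (n : ℕ) (m : (Fin n × Fin n) →₀ ℕ),
      MvPolynomial.coeff m (perPoly (Fin n) ℝ≥0) = 0 ∨ MvPolynomial.coeff m (perPoly (Fin n) ℝ≥0) = 1 := by
    intro n m
    by_cases h : MvPolynomial.coeff m (perPoly (Fin n) ℝ≥0) = 0
    · exact Or.inl h
    · obtain ⟨ρ, rfl⟩ := exists_permMonomial_eq_of_coeff_perPoly_ne_zero ℝ≥0 h
      exact Or.inr (coeff_permMonomial_perPoly ℝ≥0 ρ)
  -- and complexifies to `per` over `ℂ` (cf. `DivisionGap.map_perPoly_nnreal_family`)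
  have hmap : (fun n => MvPolynomial.map (Complex.ofRealHom.comp NNReal.toRealHom) (perPoly (Fin n) ℝ≥0)) =
      fun n => perPoly (Fin n) ℂ := funext fun n => map_perPoly _
  have hVP' : IsVPFamily (k := ℂ)
      (fun n => MvPolynomial.map (Complex.ofRealHom.comp NNReal.toRealHom) (perPoly (Fin n) ℝ≥0)) := by
    rw [hmap]
    exact hVP
  exact hZ (fun n => Fin n × Fin n) (fun n => perPoly (Fin n) ℝ≥0) hcoeff hVP'

/-- **`ValiantsHypothesis → TransferAtPer`**: the transfer at `per` is IMPLIED BY THE SUMMIT, vacuously —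
`VP_ℂ ≠ VNP_ℂ` makes `(per_n)` a non-`VP_ℂ` family (VNP-completeness of the permanent in
characteristic `≠ 2`: `perFamily_mem_VP_iff_VP_eq_VNP`, bundling bridge `mem_VP_ofFintype_iff_holds`).
[folklore] -/
theorem transferAtPer_of_valiantsHypothesis (hVH : _root_.ValiantsHypothesis) :
    IsVPFamily (k := ℂ) (fun n => perPoly (Fin n) ℂ) →
      ∃ c : ℕ, ∀ n : ℕ, ∃ h : MvPolynomial (Fin n × Fin n) ℝ≥0, h ≠ 0 ∧
        complexity (perPoly (Fin n) ℝ≥0 * h) + complexity h ≤ 2 ^ ((Nat.log 2 n + c) ^ c) := by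
  intro hVP
  have hne : VP ℂ ≠ VNP ℂ := hVH
  exact absurd ((perFamily_mem_VP_iff_VP_eq_VNP ℂ ringChar_complex_ne_two).1
    ((mem_VP_ofFintype_iff_holds _).2 hVP)) hne

/-! ### The assembly with weakened hypotheses -/

/-- **`TransferAtPer → SomewhereHard(per) → ValiantsHypothesis`**: the route-`DivisionGap` assembly
with the transfer needed only AT `per` and H1 `PerDivisionHard` needed only at SOME level for every
quasi-polynomial scale.  If `per ∈ VP_ℂ`, the transfer gives `c` and certificates at every level; H1
somewhere at this `c` contradicts one of them; so `per ∉ VP_ℂ`, whence the summit by VNP-completeness of `per`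
(`perFamily_mem_VP_iff_VP_eq_VNP`, as in the landed glue `perNotVPToVH_proof`). [folklore] -/
theorem valiantsHypothesis_of_transferAtPer_of_somewhereHard
    (hT : IsVPFamily (k := ℂ) (fun n => perPoly (Fin n) ℂ) →
      ∃ c : ℕ, ∀ n : ℕ, ∃ h : MvPolynomial (Fin n × Fin n) ℝ≥0, h ≠ 0 ∧
        complexity (perPoly (Fin n) ℝ≥0 * h) + complexity h ≤ 2 ^ ((Nat.log 2 n + c) ^ c))
    (hS : ∀ c : ℕ, ∃ n : ℕ, ∀ h : MvPolynomial (Fin n × Fin n) ℝ≥0, h ≠ 0 →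
      2 ^ ((Nat.log 2 n + c) ^ c) < complexity (perPoly (Fin n) ℝ≥0 * h) + complexity h) :
    _root_.ValiantsHypothesis := by
  -- `per ∉ VP_ℂ`
  have hnot : ¬ IsVPFamily (k := ℂ) (fun n => perPoly (Fin n) ℂ) := by
    intro hVP
    obtain ⟨c, hc⟩ := hT hVP
    obtain ⟨n, hn⟩ := hS c
    obtain ⟨h, hh, hle⟩ := hc n
    exact absurd (lt_of_lt_of_le (hn h hh) hle) (lt_irrefl _)
  -- hence `VP_ℂ ≠ VNP_ℂ` (VNP-completeness of `per`, cf. the landed glue `perNotVPToVH_proof`)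
  show VP ℂ ≠ VNP ℂ
  intro hEq
  exact hnot ((mem_VP_ofFintype_iff_holds _).1
    ((perFamily_mem_VP_iff_VP_eq_VNP ℂ ringChar_complex_ne_two).2 hEq))

/-- **`PerDivisionHard → SomewhereHard(per)`**: eventual hardness gives hardness at the level `n₀`.
[folklore] -/
theorem somewhereHard_of_perDivisionHard
    (h1 : Summit.ValiantsHypothesis.ValiantsHypothesis.Theses.DivisionGap.PerDivisionHard) :
    ∀ c : ℕ, ∃ n : ℕ, ∀ h : MvPolynomial (Fin n × Fin n) ℝ≥0, h ≠ 0 →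
      2 ^ ((Nat.log 2 n + c) ^ c) < complexity (perPoly (Fin n) ℝ≥0 * h) + complexity h := by
  intro c
  obtain ⟨n₀, hn₀⟩ := h1 c
  exact ⟨n₀, fun h hh => hn₀ n₀ le_rfl h hh⟩

/-! ### Modulo H1, the summit IS the transfer at `per` -/

/-- ★ **`SomewhereHard(per) → (ValiantsHypothesis ↔ TransferAtPer)`**: modulo division hardness of the
permanent at some level for every quasi-polynomial scale (implied by H1 `PerDivisionHard`), the summit
`VP_ℂ ≠ VNP_ℂ` is EQUIVALENT to the 0/1 division transfer at the single family `per`. [folklore] -/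
theorem valiantsHypothesis_iff_transferAtPer
    (hS : ∀ c : ℕ, ∃ n : ℕ, ∀ h : MvPolynomial (Fin n × Fin n) ℝ≥0, h ≠ 0 →
      2 ^ ((Nat.log 2 n + c) ^ c) < complexity (perPoly (Fin n) ℝ≥0 * h) + complexity h) :
    _root_.ValiantsHypothesis ↔
      (IsVPFamily (k := ℂ) (fun n => perPoly (Fin n) ℂ) →
        ∃ c : ℕ, ∀ n : ℕ, ∃ h : MvPolynomial (Fin n × Fin n) ℝ≥0, h ≠ 0 ∧
          complexity (perPoly (Fin n) ℝ≥0 * h) + complexity h ≤ 2 ^ ((Nat.log 2 n + c) ^ c)) :=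
  ⟨transferAtPer_of_valiantsHypothesis, fun hT => valiantsHypothesis_of_transferAtPer_of_somewhereHard hT hS⟩

/-- **`PerDivisionHard → (ValiantsHypothesis ↔ TransferAtPer)`**, with the registered H1 as the
hypothesis. [folklore] -/
theorem valiantsHypothesis_iff_transferAtPer_of_perDivisionHard
    (h1 : Summit.ValiantsHypothesis.ValiantsHypothesis.Theses.DivisionGap.PerDivisionHard) :
    _root_.ValiantsHypothesis ↔
      (IsVPFamily (k := ℂ) (fun n => perPoly (Fin n) ℂ) →
        ∃ c : ℕ, ∀ n : ℕ, ∃ h : MvPolynomial (Fin n × Fin n) ℝ≥0, h ≠ 0 ∧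
          complexity (perPoly (Fin n) ℝ≥0 * h) + complexity h ≤ 2 ^ ((Nat.log 2 n + c) ^ c)) :=
  valiantsHypothesis_iff_transferAtPer (somewhereHard_of_perDivisionHard h1)

/-- **The route's assembly recovered** (`PerDivisionHard → ZeroOneTransfer → ValiantsHypothesis`, cf.
the route's deciding theorem `Theses.DivisionGap.closes`) as the composition of the two weakenings.
[folklore] -/
theorem valiantsHypothesis_of_perDivisionHard_of_zeroOneTransfer
    (h1 : Summit.ValiantsHypothesis.ValiantsHypothesis.Theses.DivisionGap.PerDivisionHard)
    (hZ : Summit.ValiantsHypothesis.ValiantsHypothesis.Theses.DivisionGap.ZeroOneTransfer) :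
    _root_.ValiantsHypothesis :=
  valiantsHypothesis_of_transferAtPer_of_somewhereHard (transferAtPer_of_zeroOneTransfer hZ)
    (somewhereHard_of_perDivisionHard h1)

end Summit.ValiantsHypothesis.ValiantsHypothesis.Theorems.DivisionGapZeroOneTransfer.TransferAtPer

end
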